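import Summits.CriticalPhenomena.PercolationContinuityZ3.Theorems.Transplant.SkelNegBParamsRootCasesT
import HarnessLib

/-!
# N1 params, chain of record `NegB`, part FaceY: THE y′-FACE START WINDOW AT THE BRIDGE — origin `yLY` (core 1's α-centre shifted by the split `v_L`,
# β-centre corrected by `⌊σ·h_L·v_L / n_L⌋`) and level half-width `qBY`, with hp-8 g33's `hxaY` / `hxbY` (lane INBOX 2026-08-21T23:3xZ, verbatim
# shapes) for all three B.13 bridge frames (stmt-g15; (F) binder map)
For the y′-face the first long run is a y′-run (along `v_L`), whose start window about an origin `yL` is the parallelogram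
`{−(n_L + v_L) ≤ y₀ − σ·yL₀ ≤ n_L − v_L} ∩ {|Λ₁(y) − Λ₁(yL)| ≤ qB·U_L}` (`Λ₁(y) = n_L y₁ − h_L·(σ y₀)`, `U_L = n_L + |h_L|`). The bridge's core 1
(`KS.mem_core1_same_iff/side_iff/top_iff`) is `2w` wide in `α` and about a layer tall in `β`; it sits inside that window for the origin
`yLYof σ c₀ b₁ := (σ·(c₀ + v_L), b₁ + ⌊σ h_L v_L / n_L⌋)` (`c₀` = the core's α-centre, `b₁` = its β-centre) as soon as `w ≤ n_L` (`hxaY`), with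
`|σ(n_L(y₁ − yL₁) − h_L(σy₀ − yL₀))| ≤ n_L·q + |h_L|·w + n_L` (`q` = the core's β half-height) — so **`qBY := (n_L·q⋆ + |h_L|·w⋆ + n_L)/U_L + 1`** with the
uniform `q⋆ := ℓ_L/2 + ℓ_b/2 + n_b + RA′ + 2`, `w⋆ := RA′ + ℓ_b/2 + |h_b| + 6` serves all three frames ((R)'s x-face analogue: `KS.yLs/qBs`, `hxa_s/hxb_s`).
builds on p205010 (kernel theorem, internal audit signed; external expert review pending) — nothing in this file uses p205010; NOTHING is claimed about
the node `SamePDropOfSkeletonNeg₁` (OPEN; its (F) column is blocked on the named LEVEL-0 statement `hlin`, lead g7 RULING E2 2026-08-21T23:21Z).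
Lane `prim-bschramm-*`, seat `prim-bschramm-stmt` (gen 15); helper file (`--supports stmt-CriticalPhenomena-4575 --as helper`); ledger HOME/prim-bschramm-stmt/NEG-PARAMS.md.
* §1 `hxbY_core` (the generic level estimate), `KS.yLYof`, `KS.qStarY/wStarY/qBY`, `qBY_spec`, `qStarY_ge`, `wStarY_ge`; §2 `KS.yLYs/yLYd/yLYt` and **`hxaY_s/hxbY_s`**, **`hxaY_d/hxbY_d`**,
  **`hxaY_t/hxbY_t`** (hp-8's binder shapes, `σ = sgOf du`, `qB := qBY`).
[cite: KozmaNitzan2024, §4 Lemma 11 (pp. 22–23), Lemma 12 (pp. 23–25)] [cite: MartineauTassion2017, §4.1]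
-/

noncomputable section

open scoped Classical

namespace Summit.CriticalPhenomena.PercolationContinuityZ3.Theorems.Transplant

namespace PlanarSkeletonNeg

namespace NegB

open Literature.Probability.Percolation Literature.Probability.LatticeModels SimpleGraph
open SkelConc (Consts)
open Skelφ (shearUnit shearUnit_pos)
open Skelφ.StepI (DataN)
open Neg

namespace KS

/-! ## §1 The generic level estimate and the values -/

/-- **The level estimate of a box about a shifted origin**: with `e := ⌊σhv/n⌋`, `|y₀ − c₀| ≤ w`, `|y₁ − b₁| ≤ q` (`σ = ±1`, `1 ≤ n`),
`|σ·(n·(y₁ − (b₁ + e)) − h·(σ·y₀ − σ·(c₀ + v)))| ≤ n·q + |h|·w + n`. [folklore] -/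
theorem hxbY_core {n : ℕ} (hn : 1 ≤ n) (h v : ℤ) {σ : ℤ} (hσ : σ = 1 ∨ σ = -1) {c₀ b₁ w q y0 y1 : ℤ}
    (h0 : |y0 - c₀| ≤ w) (h1 : |y1 - b₁| ≤ q) :
    |σ * ((n : ℤ) * (y1 - (b₁ + σ * h * v / n)) - h * (σ * y0 - σ * (c₀ + v)))| ≤ (n : ℤ) * q + |h| * w + n := by
  have hn0 : (0 : ℤ) < n := by exact_mod_cast hn
  have hσsq : σ * σ = 1 := by rcases hσ with rfl | rfl <;> norm_num
  have hσabs : |σ| = 1 := by rcases hσ with rfl | rfl <;> norm_num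
  set e := σ * h * v / n with he
  set r := σ * h * v % n with hr
  have hdiv : σ * h * v = n * e + r := (Int.mul_ediv_add_emod (σ * h * v) (n : ℤ)).symm
  have hr0 : 0 ≤ r := Int.emod_nonneg _ hn0.ne'
  have hrn : r < n := Int.emod_lt_of_pos _ hn0
  -- the expression equals `σ n (y1 − b₁) − h (y0 − c₀) + σ r`
  have key : σ * ((n : ℤ) * (y1 - (b₁ + e)) - h * (σ * y0 - σ * (c₀ + v))) = σ * (n : ℤ) * (y1 - b₁) - h * (y0 - c₀) + σ * r := by
    have : (n : ℤ) * e = σ * h * v - r := by linarith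
    calc σ * ((n : ℤ) * (y1 - (b₁ + e)) - h * (σ * y0 - σ * (c₀ + v)))
        = σ * (n : ℤ) * (y1 - b₁) - σ * ((n : ℤ) * e) - σ * σ * h * (y0 - c₀) + σ * σ * h * v := by ring
      _ = σ * (n : ℤ) * (y1 - b₁) - σ * (σ * h * v - r) - 1 * h * (y0 - c₀) + 1 * h * v := by rw [this, hσsq]
      _ = σ * (n : ℤ) * (y1 - b₁) - h * (y0 - c₀) + σ * r - (σ * σ) * h * v + h * v := by ring
      _ = σ * (n : ℤ) * (y1 - b₁) - h * (y0 - c₀) + σ * r := by rw [hσsq]; ring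
  rw [key]
  have t1 : |σ * (n : ℤ) * (y1 - b₁)| ≤ (n : ℤ) * q := by
    rw [abs_mul, abs_mul, hσabs, one_mul, Nat.abs_cast]; exact mul_le_mul_of_nonneg_left h1 hn0.le
  have t2 : |h * (y0 - c₀)| ≤ |h| * w := by rw [abs_mul]; exact mul_le_mul_of_nonneg_left h0 (abs_nonneg h)
  have t3 : |σ * r| ≤ n := by rw [abs_mul, hσabs, one_mul, abs_of_nonneg hr0]; exact hrn.le
  calc |σ * (n : ℤ) * (y1 - b₁) - h * (y0 - c₀) + σ * r| ≤ |σ * (n : ℤ) * (y1 - b₁) - h * (y0 - c₀)| + |σ * r| := abs_add_le _ _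
    _ ≤ |σ * (n : ℤ) * (y1 - b₁)| + |h * (y0 - c₀)| + |σ * r| := by linarith [abs_sub (σ * (n : ℤ) * (y1 - b₁)) (h * (y0 - c₀))]
    _ ≤ (n : ℤ) * q + |h| * w + n := by linarith

section Values

variable (κ : Consts) {V : Type} [DecidableEq V] [Countable V] {G : SimpleGraph V} [G.LocallyFinite] (Φ : PlanarSkeletonNeg G) (t : V)
  (p : unitInterval) (D : DataN V) (g f mk : ℕ)

/-- **The y′-face origin about a core with α-centre `c₀` and β-centre `b₁`**: `(σ·(c₀ + v_L), b₁ + ⌊σ h_L v_L / n_L⌋)`. [this work] -/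
def yLYof (σ c₀ b₁ : ℤ) : Site 2 :=
  Skelφ.pt (σ * (c₀ + vL κ Φ t p D g f)) (b₁ + σ * hL κ Φ t p D g f * vL κ Φ t p D g f / (nL κ Φ t p D g f : ℤ))

/-- The uniform β half-height of the three cores: `q⋆ := ℓ_L/2 + ℓ_b/2 + n_b + RA′ + 2`. [this work] -/
def qStarY : ℕ := ℓL κ Φ t p D g f / 2 + ℓBR κ Φ t p D mk / 2 + nBR κ Φ t p D mk + RA' κ Φ t p D mk + 2

/-- The uniform α half-width of the three cores: `w⋆ := RA′ + ℓ_b/2 + |h_b| + 6`. [this work] -/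
def wStarY : ℕ := RA' κ Φ t p D mk + ℓBR κ Φ t p D mk / 2 + (hBR κ Φ t p D mk).natAbs + 6

/-- **THE y′-FACE START HALF-WIDTH (in level strides)** `qBY := (n_L·q⋆ + |h_L|·w⋆ + n_L)/U_L + 1`. [this work] -/
def qBY : ℕ := (nL κ Φ t p D g f * qStarY κ Φ t p D g f mk + (hL κ Φ t p D g f).natAbs * wStarY κ Φ t p D mk + nL κ Φ t p D g f) /
    shearUnit (nL κ Φ t p D g f) (hL κ Φ t p D g f) + 1

/-- `n_L·q⋆ + |h_L|·w⋆ + n_L ≤ qBY·U_L` (`1 ≤ n_L`). [folklore] -/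
theorem qBY_spec (hn : 1 ≤ nL κ Φ t p D g f) :
    (nL κ Φ t p D g f : ℤ) * (qStarY κ Φ t p D g f mk : ℤ) + |hL κ Φ t p D g f| * (wStarY κ Φ t p D mk : ℤ) + nL κ Φ t p D g f ≤
      (qBY κ Φ t p D g f mk : ℤ) * (shearUnit (nL κ Φ t p D g f) (hL κ Φ t p D g f) : ℤ) := by
  have hU : 0 < shearUnit (nL κ Φ t p D g f) (hL κ Φ t p D g f) := by unfold Skelφ.shearUnit; omega
  set X := nL κ Φ t p D g f * qStarY κ Φ t p D g f mk + (hL κ Φ t p D g f).natAbs * wStarY κ Φ t p D mk + nL κ Φ t p D g f with hX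
  have h1 : X ≤ (X / shearUnit (nL κ Φ t p D g f) (hL κ Φ t p D g f) + 1) * shearUnit (nL κ Φ t p D g f) (hL κ Φ t p D g f) := by
    rw [Nat.add_mul, one_mul]
    have := Nat.lt_div_mul_add (a := X) hU
    omega
  have h2 : ((X : ℕ) : ℤ) ≤ (qBY κ Φ t p D g f mk : ℤ) * (shearUnit (nL κ Φ t p D g f) (hL κ Φ t p D g f) : ℤ) := by
    unfold qBY; rw [← hX]; exact_mod_cast h1
  have e : ((X : ℕ) : ℤ) = (nL κ Φ t p D g f : ℤ) * (qStarY κ Φ t p D g f mk : ℤ) + |hL κ Φ t p D g f| * (wStarY κ Φ t p D mk : ℤ) + nL κ Φ t p D g f := by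
    rw [hX]; push_cast [Int.natCast_natAbs]; ring
  linarith

/-- The three cores' β half-heights are `≤ q⋆`. [folklore] -/
theorem qStarY_ge : ((ℓL κ Φ t p D g f : ℤ) + ℓBR κ Φ t p D mk) / 2 + RA' κ Φ t p D mk + 1 ≤ (qStarY κ Φ t p D g f mk : ℤ) ∧
    (ℓL κ Φ t p D g f : ℤ) / 2 + RA' κ Φ t p D mk + 1 ≤ (qStarY κ Φ t p D g f mk : ℤ) ∧
    (ℓL κ Φ t p D g f : ℤ) / 2 + nBR κ Φ t p D mk + RA' κ Φ t p D mk + 1 ≤ (qStarY κ Φ t p D g f mk : ℤ) := by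
  unfold qStarY; push_cast; omega

omit [DecidableEq V] in
/-- The three cores' α half-widths are `≤ w⋆`. [folklore] -/
theorem wStarY_ge : (RA' κ Φ t p D mk : ℤ) ≤ (wStarY κ Φ t p D mk : ℤ) ∧
    (RA' κ Φ t p D mk : ℤ) + (ℓBR κ Φ t p D mk : ℤ) / 2 + 1 ≤ (wStarY κ Φ t p D mk : ℤ) ∧
    (RA' κ Φ t p D mk : ℤ) + |hBR κ Φ t p D mk| + 6 ≤ (wStarY κ Φ t p D mk : ℤ) := by
  have e : (wStarY κ Φ t p D mk : ℤ) = (RA' κ Φ t p D mk : ℤ) + (ℓBR κ Φ t p D mk : ℤ) / 2 + |hBR κ Φ t p D mk| + 6 := by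
    unfold wStarY; push_cast [Int.natCast_natAbs]; ring
  have h0 : (0 : ℤ) ≤ (ℓBR κ Φ t p D mk : ℤ) / 2 := Int.ediv_nonneg (by positivity) (by norm_num)
  have h1 := abs_nonneg (hBR κ Φ t p D mk)
  rw [e]; refine ⟨by linarith, by linarith, by linarith⟩

end Values

/-! ## §2 The three origins and `hxaY` / `hxbY` -/

section Frames

variable (κ : Consts) {V : Type} [DecidableEq V] [Countable V] {G : SimpleGraph V} [G.LocallyFinite] (Φ : PlanarSkeletonNeg G) (t : V)
  (p : unitInterval) (D : DataN V) (mk : ℕ) (gx fx : Neg.FSlot)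

/-- **y′-face origin, case same** (`c₀ := n_L + n_b`, `b₁ := σ(h_L + h_b) + (ℓ_L + ℓ_b)/2`). [this work] -/
def yLYs (g f : ℕ) (σ : ℤ) : Site 2 :=
  yLYof κ Φ t p D g f σ ((nL κ Φ t p D g f : ℤ) + nBR κ Φ t p D mk) (σ * (hL κ Φ t p D g f + hBR κ Φ t p D mk) + ((ℓL κ Φ t p D g f : ℤ) + ℓBR κ Φ t p D mk) / 2)

/-- **y′-face origin, steep transposed case** (`c₀ := n_L + |h_b| + ℓ_b/2`, `b₁ := σ(h_L + sgnz h_b·n_b) + ℓ_L/2`). [this work] -/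
def yLYd (g f : ℕ) (σ : ℤ) : Site 2 :=
  yLYof κ Φ t p D g f σ ((nL κ Φ t p D g f : ℤ) + |hBR κ Φ t p D mk| + (ℓBR κ Φ t p D mk : ℤ) / 2)
    (σ * (hL κ Φ t p D g f + Skelφ.sgnz (hBR κ Φ t p D mk) * nBR κ Φ t p D mk) + (ℓL κ Φ t p D g f : ℤ) / 2)

/-- **y′-face origin, flat transposed case** (`c₀ := n_L + ℓ_b − 5`, `b₁ := σh_L + ℓ_L/2`). [this work] -/
def yLYt (g f : ℕ) (σ : ℤ) : Site 2 :=
  yLYof κ Φ t p D g f σ ((nL κ Φ t p D g f : ℤ) + ℓBR κ Φ t p D mk - 5) (σ * hL κ Φ t p D g f + (ℓL κ Φ t p D g f : ℤ) / 2)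

variable {κ Φ t p D mk gx fx}

/-- The `hxaY` arithmetic: `|y₀ − c₀| ≤ w ≤ n_L` and `|v_L| ≤ n_L` give hp-8's two-sided bound with the `toNat` casts. [folklore] -/
theorem hxaY_core {n : ℕ} {v σ y0 yL0 : ℤ} (c₀ w : ℤ) (hσ : σ = 1 ∨ σ = -1) (hv : |v| ≤ (n : ℤ)) (hwn : w ≤ (n : ℤ)) (h0 : |y0 - c₀| ≤ w)
    (hyL : yL0 = σ * (c₀ + v)) :
    -((((n : ℤ) + v).toNat : ℕ) : ℤ) ≤ y0 - σ * yL0 ∧ y0 - σ * yL0 ≤ ((((n : ℤ) - v).toNat : ℕ) : ℤ) := by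
  have hσsq : σ * σ = 1 := by rcases hσ with rfl | rfl <;> norm_num
  obtain ⟨hv1, hv2⟩ := abs_le.1 hv
  obtain ⟨h01, h02⟩ := abs_le.1 h0
  have e : σ * yL0 = c₀ + v := by rw [hyL, ← mul_assoc, hσsq, one_mul]
  rw [e, Int.toNat_of_nonneg (by linarith), Int.toNat_of_nonneg (by linarith)]
  constructor <;> linarith

variable (κ Φ t p D mk gx fx)

/-- **`hxaY`, case same.** [folklore] -/
theorem hxaY_s (hN : EqNumL κ Φ t p D (gT mk gx κ Φ t p D) (fT mk fx κ Φ t p D)) {σ : ℤ} (hσ : σ = 1 ∨ σ = -1) :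
    ∀ y ∈ Finset.Icc (Skelφ.bridgeSame σ (nL κ Φ t p D (gT mk gx κ Φ t p D) (fT mk fx κ Φ t p D)) (hL κ Φ t p D (gT mk gx κ Φ t p D) (fT mk fx κ Φ t p D))
          (ℓL κ Φ t p D (gT mk gx κ Φ t p D) (fT mk fx κ Φ t p D)) (RA' κ Φ t p D mk) (nBR κ Φ t p D mk) (hBR κ Φ t p D mk) (ℓBR κ Φ t p D mk)).core1Lo
        (Skelφ.bridgeSame σ (nL κ Φ t p D (gT mk gx κ Φ t p D) (fT mk fx κ Φ t p D)) (hL κ Φ t p D (gT mk gx κ Φ t p D) (fT mk fx κ Φ t p D))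
          (ℓL κ Φ t p D (gT mk gx κ Φ t p D) (fT mk fx κ Φ t p D)) (RA' κ Φ t p D mk) (nBR κ Φ t p D mk) (hBR κ Φ t p D mk) (ℓBR κ Φ t p D mk)).core1Hi,
      -((((nL κ Φ t p D (gT mk gx κ Φ t p D) (fT mk fx κ Φ t p D) : ℤ) + vL κ Φ t p D (gT mk gx κ Φ t p D) (fT mk fx κ Φ t p D)).toNat : ℕ) : ℤ) ≤
          y 0 - σ * yLYs κ Φ t p D mk (gT mk gx κ Φ t p D) (fT mk fx κ Φ t p D) σ 0 ∧
        y 0 - σ * yLYs κ Φ t p D mk (gT mk gx κ Φ t p D) (fT mk fx κ Φ t p D) σ 0 ≤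
          ((((nL κ Φ t p D (gT mk gx κ Φ t p D) (fT mk fx κ Φ t p D) : ℤ) - vL κ Φ t p D (gT mk gx κ Φ t p D) (fT mk fx κ Φ t p D)).toNat : ℕ) : ℤ) := by
  intro y hy
  rw [mem_core1_same_iff] at hy
  obtain ⟨⟨h0l, h0u⟩, -⟩ := hy
  have hRn : (RA' κ Φ t p D mk : ℤ) ≤ nL κ Φ t p D (gT mk gx κ Φ t p D) (fT mk fx κ Φ t p D) := by exact_mod_cast hRn_R κ Φ t p D mk gx fx
  refine hxaY_core ((nL κ Φ t p D (gT mk gx κ Φ t p D) (fT mk fx κ Φ t p D) : ℤ) + nBR κ Φ t p D mk) (RA' κ Φ t p D mk : ℤ) hσ hN.v_le hRn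
    (abs_le.2 ⟨by linarith, by linarith⟩) ?_
  unfold yLYs yLYof; rw [Skelφ.pt_zero]

/-- **`hxbY`, case same** (`qB := qBY`). [folklore] -/
theorem hxbY_s (hN : EqNumL κ Φ t p D (gT mk gx κ Φ t p D) (fT mk fx κ Φ t p D)) {σ : ℤ} (hσ : σ = 1 ∨ σ = -1) :
    ∀ y ∈ Finset.Icc (Skelφ.bridgeSame σ (nL κ Φ t p D (gT mk gx κ Φ t p D) (fT mk fx κ Φ t p D)) (hL κ Φ t p D (gT mk gx κ Φ t p D) (fT mk fx κ Φ t p D))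
          (ℓL κ Φ t p D (gT mk gx κ Φ t p D) (fT mk fx κ Φ t p D)) (RA' κ Φ t p D mk) (nBR κ Φ t p D mk) (hBR κ Φ t p D mk) (ℓBR κ Φ t p D mk)).core1Lo
        (Skelφ.bridgeSame σ (nL κ Φ t p D (gT mk gx κ Φ t p D) (fT mk fx κ Φ t p D)) (hL κ Φ t p D (gT mk gx κ Φ t p D) (fT mk fx κ Φ t p D))
          (ℓL κ Φ t p D (gT mk gx κ Φ t p D) (fT mk fx κ Φ t p D)) (RA' κ Φ t p D mk) (nBR κ Φ t p D mk) (hBR κ Φ t p D mk) (ℓBR κ Φ t p D mk)).core1Hi,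
      |σ * ((nL κ Φ t p D (gT mk gx κ Φ t p D) (fT mk fx κ Φ t p D) : ℤ) * (y 1 - yLYs κ Φ t p D mk (gT mk gx κ Φ t p D) (fT mk fx κ Φ t p D) σ 1) -
            hL κ Φ t p D (gT mk gx κ Φ t p D) (fT mk fx κ Φ t p D) * (σ * y 0 - yLYs κ Φ t p D mk (gT mk gx κ Φ t p D) (fT mk fx κ Φ t p D) σ 0))| +
          (shearUnit (nL κ Φ t p D (gT mk gx κ Φ t p D) (fT mk fx κ Φ t p D)) (hL κ Φ t p D (gT mk gx κ Φ t p D) (fT mk fx κ Φ t p D)) : ℤ) ≤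
        ((qBY κ Φ t p D (gT mk gx κ Φ t p D) (fT mk fx κ Φ t p D) mk : ℤ) + 1) *
          (shearUnit (nL κ Φ t p D (gT mk gx κ Φ t p D) (fT mk fx κ Φ t p D)) (hL κ Φ t p D (gT mk gx κ Φ t p D) (fT mk fx κ Φ t p D)) : ℤ) := by
  intro y hy
  rw [mem_core1_same_iff] at hy
  obtain ⟨⟨h0l, h0u⟩, ⟨h1l, h1u⟩⟩ := hy
  obtain ⟨hn1, -⟩ := one_le_of_eqNumL κ Φ t p D _ _ hN
  set n := nL κ Φ t p D (gT mk gx κ Φ t p D) (fT mk fx κ Φ t p D) with hn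
  set h := hL κ Φ t p D (gT mk gx κ Φ t p D) (fT mk fx κ Φ t p D) with hh
  set ℓ := ℓL κ Φ t p D (gT mk gx κ Φ t p D) (fT mk fx κ Φ t p D) with hℓ
  set v := vL κ Φ t p D (gT mk gx κ Φ t p D) (fT mk fx κ Φ t p D) with hv
  have hspec := qBY_spec κ Φ t p D (gT mk gx κ Φ t p D) (fT mk fx κ Φ t p D) mk hn1
  -- the core about (c₀, b₁) with half-sizes (RA′, (ℓ_L+ℓ_b)/2 + RA′ + 1)
  have hR0 : (0 : ℤ) ≤ (RA' κ Φ t p D mk : ℤ) := by positivity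
  have hb : |y 1 - (σ * (h + hBR κ Φ t p D mk) + ((ℓ : ℤ) + ℓBR κ Φ t p D mk) / 2)| ≤ ((ℓ : ℤ) + ℓBR κ Φ t p D mk) / 2 + RA' κ Φ t p D mk + 1 := by
    have hd := Int.mul_ediv_add_emod ((ℓ : ℤ) + ℓBR κ Φ t p D mk) 2
    have hm0 := Int.emod_nonneg ((ℓ : ℤ) + ℓBR κ Φ t p D mk) (by norm_num : (2 : ℤ) ≠ 0)
    have hm1 := Int.emod_lt_of_pos ((ℓ : ℤ) + ℓBR κ Φ t p D mk) (by norm_num : (0 : ℤ) < 2)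
    rw [abs_le]; constructor <;> linarith
  have ha : |y 0 - ((n : ℤ) + nBR κ Φ t p D mk)| ≤ (RA' κ Φ t p D mk : ℤ) := abs_le.2 ⟨by linarith, by linarith⟩
  have hq0 : (0 : ℤ) ≤ ((ℓ : ℤ) + ℓBR κ Φ t p D mk) / 2 + RA' κ Φ t p D mk + 1 := by
    have : (0 : ℤ) ≤ ((ℓ : ℤ) + ℓBR κ Φ t p D mk) / 2 := Int.ediv_nonneg (by positivity) (by norm_num)
    linarith
  have key := hxbY_core hn1 h v hσ ha hb
  -- compare with the uniform (q⋆, w⋆)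
  have hq' := (qStarY_ge κ Φ t p D (gT mk gx κ Φ t p D) (fT mk fx κ Φ t p D) mk).1
  have hw' := (wStarY_ge κ Φ t p D mk).1
  have hn0 : (0 : ℤ) ≤ (n : ℤ) := by positivity
  have e0 : yLYs κ Φ t p D mk (gT mk gx κ Φ t p D) (fT mk fx κ Φ t p D) σ 0 = σ * (((n : ℤ) + nBR κ Φ t p D mk) + v) := by
    unfold yLYs yLYof; rw [Skelφ.pt_zero]
  have e1 : yLYs κ Φ t p D mk (gT mk gx κ Φ t p D) (fT mk fx κ Φ t p D) σ 1 =
      (σ * (h + hBR κ Φ t p D mk) + ((ℓ : ℤ) + ℓBR κ Φ t p D mk) / 2) + σ * h * v / (n : ℤ) := by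
    unfold yLYs yLYof; rw [Skelφ.pt_one]
  rw [e0, e1]
  have hmono : (n : ℤ) * (((ℓ : ℤ) + ℓBR κ Φ t p D mk) / 2 + RA' κ Φ t p D mk + 1) + |h| * (RA' κ Φ t p D mk : ℤ) + n ≤
      (n : ℤ) * (qStarY κ Φ t p D (gT mk gx κ Φ t p D) (fT mk fx κ Φ t p D) mk : ℤ) + |h| * (wStarY κ Φ t p D mk : ℤ) + n := by
    have := abs_nonneg h; nlinarith
  linarith

/-- **`hxaY`, steep transposed case.** [folklore] -/
theorem hxaY_d (hN : EqNumL κ Φ t p D (gT mk gx κ Φ t p D) (fT mk fx κ Φ t p D)) {σ : ℤ} (hσ : σ = 1 ∨ σ = -1) :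
    ∀ y ∈ Finset.Icc (Skelφ.bridgeTrSide σ (nL κ Φ t p D (gT mk gx κ Φ t p D) (fT mk fx κ Φ t p D)) (hL κ Φ t p D (gT mk gx κ Φ t p D) (fT mk fx κ Φ t p D))
          (ℓL κ Φ t p D (gT mk gx κ Φ t p D) (fT mk fx κ Φ t p D)) (RA' κ Φ t p D mk) (nBR κ Φ t p D mk) (hBR κ Φ t p D mk) (ℓBR κ Φ t p D mk)).core1Lo
        (Skelφ.bridgeTrSide σ (nL κ Φ t p D (gT mk gx κ Φ t p D) (fT mk fx κ Φ t p D)) (hL κ Φ t p D (gT mk gx κ Φ t p D) (fT mk fx κ Φ t p D))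
          (ℓL κ Φ t p D (gT mk gx κ Φ t p D) (fT mk fx κ Φ t p D)) (RA' κ Φ t p D mk) (nBR κ Φ t p D mk) (hBR κ Φ t p D mk) (ℓBR κ Φ t p D mk)).core1Hi,
      -((((nL κ Φ t p D (gT mk gx κ Φ t p D) (fT mk fx κ Φ t p D) : ℤ) + vL κ Φ t p D (gT mk gx κ Φ t p D) (fT mk fx κ Φ t p D)).toNat : ℕ) : ℤ) ≤
          y 0 - σ * yLYd κ Φ t p D mk (gT mk gx κ Φ t p D) (fT mk fx κ Φ t p D) σ 0 ∧
        y 0 - σ * yLYd κ Φ t p D mk (gT mk gx κ Φ t p D) (fT mk fx κ Φ t p D) σ 0 ≤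
          ((((nL κ Φ t p D (gT mk gx κ Φ t p D) (fT mk fx κ Φ t p D) : ℤ) - vL κ Φ t p D (gT mk gx κ Φ t p D) (fT mk fx κ Φ t p D)).toNat : ℕ) : ℤ) := by
  intro y hy
  rw [mem_core1_side_iff] at hy
  obtain ⟨⟨h0l, h0u⟩, -⟩ := hy
  have h4 := (four_qBdt_le κ Φ t p D mk gx fx).1
  have hw : (RA' κ Φ t p D mk : ℤ) + (ℓBR κ Φ t p D mk : ℤ) / 2 + 1 ≤ nL κ Φ t p D (gT mk gx κ Φ t p D) (fT mk fx κ Φ t p D) := by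
    unfold qBd at h4; omega
  have hd := Int.mul_ediv_add_emod (ℓBR κ Φ t p D mk : ℤ) 2
  have hm0 := Int.emod_nonneg (ℓBR κ Φ t p D mk : ℤ) (by norm_num : (2 : ℤ) ≠ 0)
  have hm1 := Int.emod_lt_of_pos (ℓBR κ Φ t p D mk : ℤ) (by norm_num : (0 : ℤ) < 2)
  refine hxaY_core ((nL κ Φ t p D (gT mk gx κ Φ t p D) (fT mk fx κ Φ t p D) : ℤ) + |hBR κ Φ t p D mk| + (ℓBR κ Φ t p D mk : ℤ) / 2)
    ((RA' κ Φ t p D mk : ℤ) + (ℓBR κ Φ t p D mk : ℤ) / 2 + 1) hσ hN.v_le hw (abs_le.2 ⟨by linarith, by linarith⟩) ?_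
  unfold yLYd yLYof; rw [Skelφ.pt_zero]

/-- **`hxbY`, steep transposed case** (`qB := qBY`). [folklore] -/
theorem hxbY_d (hN : EqNumL κ Φ t p D (gT mk gx κ Φ t p D) (fT mk fx κ Φ t p D)) {σ : ℤ} (hσ : σ = 1 ∨ σ = -1) :
    ∀ y ∈ Finset.Icc (Skelφ.bridgeTrSide σ (nL κ Φ t p D (gT mk gx κ Φ t p D) (fT mk fx κ Φ t p D)) (hL κ Φ t p D (gT mk gx κ Φ t p D) (fT mk fx κ Φ t p D))
          (ℓL κ Φ t p D (gT mk gx κ Φ t p D) (fT mk fx κ Φ t p D)) (RA' κ Φ t p D mk) (nBR κ Φ t p D mk) (hBR κ Φ t p D mk) (ℓBR κ Φ t p D mk)).core1Lo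
        (Skelφ.bridgeTrSide σ (nL κ Φ t p D (gT mk gx κ Φ t p D) (fT mk fx κ Φ t p D)) (hL κ Φ t p D (gT mk gx κ Φ t p D) (fT mk fx κ Φ t p D))
          (ℓL κ Φ t p D (gT mk gx κ Φ t p D) (fT mk fx κ Φ t p D)) (RA' κ Φ t p D mk) (nBR κ Φ t p D mk) (hBR κ Φ t p D mk) (ℓBR κ Φ t p D mk)).core1Hi,
      |σ * ((nL κ Φ t p D (gT mk gx κ Φ t p D) (fT mk fx κ Φ t p D) : ℤ) * (y 1 - yLYd κ Φ t p D mk (gT mk gx κ Φ t p D) (fT mk fx κ Φ t p D) σ 1) -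
            hL κ Φ t p D (gT mk gx κ Φ t p D) (fT mk fx κ Φ t p D) * (σ * y 0 - yLYd κ Φ t p D mk (gT mk gx κ Φ t p D) (fT mk fx κ Φ t p D) σ 0))| +
          (shearUnit (nL κ Φ t p D (gT mk gx κ Φ t p D) (fT mk fx κ Φ t p D)) (hL κ Φ t p D (gT mk gx κ Φ t p D) (fT mk fx κ Φ t p D)) : ℤ) ≤
        ((qBY κ Φ t p D (gT mk gx κ Φ t p D) (fT mk fx κ Φ t p D) mk : ℤ) + 1) *
          (shearUnit (nL κ Φ t p D (gT mk gx κ Φ t p D) (fT mk fx κ Φ t p D)) (hL κ Φ t p D (gT mk gx κ Φ t p D) (fT mk fx κ Φ t p D)) : ℤ) := by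
  intro y hy
  rw [mem_core1_side_iff] at hy
  obtain ⟨⟨h0l, h0u⟩, ⟨h1l, h1u⟩⟩ := hy
  obtain ⟨hn1, -⟩ := one_le_of_eqNumL κ Φ t p D _ _ hN
  set n := nL κ Φ t p D (gT mk gx κ Φ t p D) (fT mk fx κ Φ t p D) with hn
  set h := hL κ Φ t p D (gT mk gx κ Φ t p D) (fT mk fx κ Φ t p D) with hh
  set ℓ := ℓL κ Φ t p D (gT mk gx κ Φ t p D) (fT mk fx κ Φ t p D) with hℓ
  set v := vL κ Φ t p D (gT mk gx κ Φ t p D) (fT mk fx κ Φ t p D) with hv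
  have hspec := qBY_spec κ Φ t p D (gT mk gx κ Φ t p D) (fT mk fx κ Φ t p D) mk hn1
  have hR0 : (0 : ℤ) ≤ (RA' κ Φ t p D mk : ℤ) := by positivity
  have hd := Int.mul_ediv_add_emod (ℓBR κ Φ t p D mk : ℤ) 2
  have hm0 := Int.emod_nonneg (ℓBR κ Φ t p D mk : ℤ) (by norm_num : (2 : ℤ) ≠ 0)
  have hm1 := Int.emod_lt_of_pos (ℓBR κ Φ t p D mk : ℤ) (by norm_num : (0 : ℤ) < 2)
  have hd' := Int.mul_ediv_add_emod (ℓ : ℤ) 2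
  have hm0' := Int.emod_nonneg (ℓ : ℤ) (by norm_num : (2 : ℤ) ≠ 0)
  have hm1' := Int.emod_lt_of_pos (ℓ : ℤ) (by norm_num : (0 : ℤ) < 2)
  have hw0 : (0 : ℤ) ≤ (RA' κ Φ t p D mk : ℤ) + (ℓBR κ Φ t p D mk : ℤ) / 2 + 1 := by
    have : (0 : ℤ) ≤ (ℓBR κ Φ t p D mk : ℤ) / 2 := Int.ediv_nonneg (by positivity) (by norm_num)
    linarith
  have hq0 : (0 : ℤ) ≤ (ℓ : ℤ) / 2 + RA' κ Φ t p D mk + 1 := by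
    have : (0 : ℤ) ≤ (ℓ : ℤ) / 2 := Int.ediv_nonneg (by positivity) (by norm_num)
    linarith
  have ha : |y 0 - ((n : ℤ) + |hBR κ Φ t p D mk| + (ℓBR κ Φ t p D mk : ℤ) / 2)| ≤ (RA' κ Φ t p D mk : ℤ) + (ℓBR κ Φ t p D mk : ℤ) / 2 + 1 := by
    rw [abs_le]; constructor <;> linarith
  have hb : |y 1 - (σ * (h + Skelφ.sgnz (hBR κ Φ t p D mk) * nBR κ Φ t p D mk) + (ℓ : ℤ) / 2)| ≤ (ℓ : ℤ) / 2 + RA' κ Φ t p D mk + 1 := by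
    have e : σ * (h + Skelφ.sgnz (hBR κ Φ t p D mk) * nBR κ Φ t p D mk) = σ * h + σ * Skelφ.sgnz (hBR κ Φ t p D mk) * nBR κ Φ t p D mk := by ring
    rw [e, abs_le]; constructor <;> linarith
  have key := hxbY_core hn1 h v hσ ha hb
  have hq' := (qStarY_ge κ Φ t p D (gT mk gx κ Φ t p D) (fT mk fx κ Φ t p D) mk).2.1
  have hw' := (wStarY_ge κ Φ t p D mk).2.1
  have hn0 : (0 : ℤ) ≤ (n : ℤ) := by positivity
  have e0 : yLYd κ Φ t p D mk (gT mk gx κ Φ t p D) (fT mk fx κ Φ t p D) σ 0 = σ * (((n : ℤ) + |hBR κ Φ t p D mk| + (ℓBR κ Φ t p D mk : ℤ) / 2) + v) := by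
    unfold yLYd yLYof; rw [Skelφ.pt_zero]
  have e1 : yLYd κ Φ t p D mk (gT mk gx κ Φ t p D) (fT mk fx κ Φ t p D) σ 1 =
      (σ * (h + Skelφ.sgnz (hBR κ Φ t p D mk) * nBR κ Φ t p D mk) + (ℓ : ℤ) / 2) + σ * h * v / (n : ℤ) := by
    unfold yLYd yLYof; rw [Skelφ.pt_one]
  rw [e0, e1]
  have hmono : (n : ℤ) * ((ℓ : ℤ) / 2 + RA' κ Φ t p D mk + 1) + |h| * ((RA' κ Φ t p D mk : ℤ) + (ℓBR κ Φ t p D mk : ℤ) / 2 + 1) + n ≤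
      (n : ℤ) * (qStarY κ Φ t p D (gT mk gx κ Φ t p D) (fT mk fx κ Φ t p D) mk : ℤ) + |h| * (wStarY κ Φ t p D mk : ℤ) + n := by
    have := abs_nonneg h; nlinarith
  linarith

/-- **`hxaY`, flat transposed case.** [folklore] -/
theorem hxaY_t (hN : EqNumL κ Φ t p D (gT mk gx κ Φ t p D) (fT mk fx κ Φ t p D)) {σ : ℤ} (hσ : σ = 1 ∨ σ = -1) :
    ∀ y ∈ Finset.Icc (Skelφ.bridgeTrTop σ (nL κ Φ t p D (gT mk gx κ Φ t p D) (fT mk fx κ Φ t p D)) (hL κ Φ t p D (gT mk gx κ Φ t p D) (fT mk fx κ Φ t p D))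
          (ℓL κ Φ t p D (gT mk gx κ Φ t p D) (fT mk fx κ Φ t p D)) (RA' κ Φ t p D mk) (nBR κ Φ t p D mk) (hBR κ Φ t p D mk) (ℓBR κ Φ t p D mk)).core1Lo
        (Skelφ.bridgeTrTop σ (nL κ Φ t p D (gT mk gx κ Φ t p D) (fT mk fx κ Φ t p D)) (hL κ Φ t p D (gT mk gx κ Φ t p D) (fT mk fx κ Φ t p D))
          (ℓL κ Φ t p D (gT mk gx κ Φ t p D) (fT mk fx κ Φ t p D)) (RA' κ Φ t p D mk) (nBR κ Φ t p D mk) (hBR κ Φ t p D mk) (ℓBR κ Φ t p D mk)).core1Hi,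
      -((((nL κ Φ t p D (gT mk gx κ Φ t p D) (fT mk fx κ Φ t p D) : ℤ) + vL κ Φ t p D (gT mk gx κ Φ t p D) (fT mk fx κ Φ t p D)).toNat : ℕ) : ℤ) ≤
          y 0 - σ * yLYt κ Φ t p D mk (gT mk gx κ Φ t p D) (fT mk fx κ Φ t p D) σ 0 ∧
        y 0 - σ * yLYt κ Φ t p D mk (gT mk gx κ Φ t p D) (fT mk fx κ Φ t p D) σ 0 ≤
          ((((nL κ Φ t p D (gT mk gx κ Φ t p D) (fT mk fx κ Φ t p D) : ℤ) - vL κ Φ t p D (gT mk gx κ Φ t p D) (fT mk fx κ Φ t p D)).toNat : ℕ) : ℤ) := by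
  intro y hy
  rw [mem_core1_top_iff] at hy
  obtain ⟨⟨h0l, h0u⟩, -⟩ := hy
  have h4 := (four_qBdt_le κ Φ t p D mk gx fx).2
  have hw : (RA' κ Φ t p D mk : ℤ) + |hBR κ Φ t p D mk| + 6 ≤ nL κ Φ t p D (gT mk gx κ Φ t p D) (fT mk fx κ Φ t p D) := by
    unfold qBt at h4
    have : ((4 * (RA' κ Φ t p D mk + (hBR κ Φ t p D mk).natAbs + 6) : ℕ) : ℤ) ≤ (nL κ Φ t p D (gT mk gx κ Φ t p D) (fT mk fx κ Φ t p D) : ℤ) := by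
      exact_mod_cast h4
    push_cast [Int.natCast_natAbs] at this
    linarith [abs_nonneg (hBR κ Φ t p D mk)]
  refine hxaY_core ((nL κ Φ t p D (gT mk gx κ Φ t p D) (fT mk fx κ Φ t p D) : ℤ) + ℓBR κ Φ t p D mk - 5) ((RA' κ Φ t p D mk : ℤ) + |hBR κ Φ t p D mk| + 6)
    hσ hN.v_le hw (abs_le.2 ⟨by linarith, by linarith⟩) ?_
  unfold yLYt yLYof; rw [Skelφ.pt_zero]

/-- **`hxbY`, flat transposed case** (`qB := qBY`). [folklore] -/
theorem hxbY_t (hN : EqNumL κ Φ t p D (gT mk gx κ Φ t p D) (fT mk fx κ Φ t p D)) {σ : ℤ} (hσ : σ = 1 ∨ σ = -1) :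
    ∀ y ∈ Finset.Icc (Skelφ.bridgeTrTop σ (nL κ Φ t p D (gT mk gx κ Φ t p D) (fT mk fx κ Φ t p D)) (hL κ Φ t p D (gT mk gx κ Φ t p D) (fT mk fx κ Φ t p D))
          (ℓL κ Φ t p D (gT mk gx κ Φ t p D) (fT mk fx κ Φ t p D)) (RA' κ Φ t p D mk) (nBR κ Φ t p D mk) (hBR κ Φ t p D mk) (ℓBR κ Φ t p D mk)).core1Lo
        (Skelφ.bridgeTrTop σ (nL κ Φ t p D (gT mk gx κ Φ t p D) (fT mk fx κ Φ t p D)) (hL κ Φ t p D (gT mk gx κ Φ t p D) (fT mk fx κ Φ t p D))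
          (ℓL κ Φ t p D (gT mk gx κ Φ t p D) (fT mk fx κ Φ t p D)) (RA' κ Φ t p D mk) (nBR κ Φ t p D mk) (hBR κ Φ t p D mk) (ℓBR κ Φ t p D mk)).core1Hi,
      |σ * ((nL κ Φ t p D (gT mk gx κ Φ t p D) (fT mk fx κ Φ t p D) : ℤ) * (y 1 - yLYt κ Φ t p D mk (gT mk gx κ Φ t p D) (fT mk fx κ Φ t p D) σ 1) -
            hL κ Φ t p D (gT mk gx κ Φ t p D) (fT mk fx κ Φ t p D) * (σ * y 0 - yLYt κ Φ t p D mk (gT mk gx κ Φ t p D) (fT mk fx κ Φ t p D) σ 0))| +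
          (shearUnit (nL κ Φ t p D (gT mk gx κ Φ t p D) (fT mk fx κ Φ t p D)) (hL κ Φ t p D (gT mk gx κ Φ t p D) (fT mk fx κ Φ t p D)) : ℤ) ≤
        ((qBY κ Φ t p D (gT mk gx κ Φ t p D) (fT mk fx κ Φ t p D) mk : ℤ) + 1) *
          (shearUnit (nL κ Φ t p D (gT mk gx κ Φ t p D) (fT mk fx κ Φ t p D)) (hL κ Φ t p D (gT mk gx κ Φ t p D) (fT mk fx κ Φ t p D)) : ℤ) := by
  intro y hy
  rw [mem_core1_top_iff] at hy
  obtain ⟨⟨h0l, h0u⟩, ⟨h1l, h1u⟩⟩ := hy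
  obtain ⟨hn1, -⟩ := one_le_of_eqNumL κ Φ t p D _ _ hN
  set n := nL κ Φ t p D (gT mk gx κ Φ t p D) (fT mk fx κ Φ t p D) with hn
  set h := hL κ Φ t p D (gT mk gx κ Φ t p D) (fT mk fx κ Φ t p D) with hh
  set ℓ := ℓL κ Φ t p D (gT mk gx κ Φ t p D) (fT mk fx κ Φ t p D) with hℓ
  set v := vL κ Φ t p D (gT mk gx κ Φ t p D) (fT mk fx κ Φ t p D) with hv
  have hspec := qBY_spec κ Φ t p D (gT mk gx κ Φ t p D) (fT mk fx κ Φ t p D) mk hn1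
  have hR0 : (0 : ℤ) ≤ (RA' κ Φ t p D mk : ℤ) := by positivity
  have hnb0 : (0 : ℤ) ≤ (nBR κ Φ t p D mk : ℤ) := by positivity
  have hd' := Int.mul_ediv_add_emod (ℓ : ℤ) 2
  have hm0' := Int.emod_nonneg (ℓ : ℤ) (by norm_num : (2 : ℤ) ≠ 0)
  have hm1' := Int.emod_lt_of_pos (ℓ : ℤ) (by norm_num : (0 : ℤ) < 2)
  have hba := abs_nonneg (hBR κ Φ t p D mk)
  have hw0 : (0 : ℤ) ≤ (RA' κ Φ t p D mk : ℤ) + |hBR κ Φ t p D mk| + 6 := by linarith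
  have hq0 : (0 : ℤ) ≤ (ℓ : ℤ) / 2 + nBR κ Φ t p D mk + RA' κ Φ t p D mk + 1 := by
    have : (0 : ℤ) ≤ (ℓ : ℤ) / 2 := Int.ediv_nonneg (by positivity) (by norm_num)
    linarith
  have ha : |y 0 - ((n : ℤ) + ℓBR κ Φ t p D mk - 5)| ≤ (RA' κ Φ t p D mk : ℤ) + |hBR κ Φ t p D mk| + 6 := by
    rw [abs_le]; constructor <;> linarith
  have hb : |y 1 - (σ * h + (ℓ : ℤ) / 2)| ≤ (ℓ : ℤ) / 2 + nBR κ Φ t p D mk + RA' κ Φ t p D mk + 1 := by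
    rw [abs_le]; constructor <;> linarith
  have key := hxbY_core hn1 h v hσ ha hb
  have hq' := (qStarY_ge κ Φ t p D (gT mk gx κ Φ t p D) (fT mk fx κ Φ t p D) mk).2.2
  have hw' := (wStarY_ge κ Φ t p D mk).2.2
  have hn0 : (0 : ℤ) ≤ (n : ℤ) := by positivity
  have e0 : yLYt κ Φ t p D mk (gT mk gx κ Φ t p D) (fT mk fx κ Φ t p D) σ 0 = σ * (((n : ℤ) + ℓBR κ Φ t p D mk - 5) + v) := by
    unfold yLYt yLYof; rw [Skelφ.pt_zero]
  have e1 : yLYt κ Φ t p D mk (gT mk gx κ Φ t p D) (fT mk fx κ Φ t p D) σ 1 = (σ * h + (ℓ : ℤ) / 2) + σ * h * v / (n : ℤ) := by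
    unfold yLYt yLYof; rw [Skelφ.pt_one]
  rw [e0, e1]
  have hmono : (n : ℤ) * ((ℓ : ℤ) / 2 + nBR κ Φ t p D mk + RA' κ Φ t p D mk + 1) + |h| * ((RA' κ Φ t p D mk : ℤ) + |hBR κ Φ t p D mk| + 6) + n ≤
      (n : ℤ) * (qStarY κ Φ t p D (gT mk gx κ Φ t p D) (fT mk fx κ Φ t p D) mk : ℤ) + |h| * (wStarY κ Φ t p D mk : ℤ) + n := by
    have := abs_nonneg h; nlinarith
  linarith

end Frames

end KS

end NegB

end PlanarSkeletonNeg

end Summit.CriticalPhenomena.PercolationContinuityZ3.Theorems.Transplant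

end
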